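import Summits.Ventures.HodgeRepro2.T6NAut

/-!
# T6N41Tau — the pure-tensor test data of the Rallis inner-product formula (Tier 6, M2; definition lane; owner t6-p4)

THE RESIDUAL NARROWED HERE.  `N4_main` (T6N4Main) passes N4's conclusion `(R1) ∧ (H_loc)` to Proposition N*'s
hypothesis (i) — `N3Side.hypI`: «there are `f ∈ π₀` with archimedean component in `τ′` and `φ_f ∈ 𝒮(𝕏(𝔸_f))`
with `Θ(f, φ₁₂,∞ ⊗ φ_f) ≠ 0`» — through the display `GQT2014_Thm11_7_ii` («the global theta lift is non-zero»,
`σ ≠ ⊥`) and the residual binder `hτ' : σ ≠ ⊥ → hypI` (class IR), because the data of the accepted files carry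
no restricted-tensor structure on which GQT's Rallis inner-product formula (Theorem 11.4(ii), (11.3)) could be
stated.  The record closes (i) from `(R1) ∧ (R2) ∧ (R3)` exactly through that formula (TIER5 N3 l. 1059
«hypothesis (i) of N* ← N4 = (R1) ∧ (R2) ∧ (R3) (MEMO §15.4, §15.6)»; MEMO-route-2 §15.4 (R2)–(R3): (R2) is
GQT Thm 33(ii)(a) = Prop. 11.6(i) at the finite places — in kernel t6-p5's `N42_zeta_main` (T6N42Main, row B0:
`Z_v^*(½) ≢ 0` on `R(V_v) ⊗ π₀,v^∨ ⊗ π₀,v` at every finite place, from the display `GQT2014_Prop35_i`); at the real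
places the diagonal vector is FORCED — the Fock datum and the one-dimensional `τ′`-part — and (R3) is the
non-vanishing of the archimedean normalised doubling integrals on it, t6-p6's `N43_places`).  This file
supplies the carrier; T6N41TauHyp displays the two printed inputs not yet in the tree (GQT Thm 11.4(ii) with
(11.3), §11.6's unramified identity); T6N41TauMain proves `hypI` from them, t6-p5's zeta form and t6-p6's
archimedean non-vanishing, with the product / non-vanishing bookkeeping in kernel (Mathlib's
`tprod_one_add_ne_zero_of_summable`); T6N4PlacedTau is the N4 assembly on that form — `hτ'` GONE.

THE CARRIER.  A quadruple `PureData X s` = GQT's global test data `(φ₁, φ₂, f₁, f₂)` (Theorem 11.4(i)–(ii):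
`φ₁, φ₂ ∈ ω`, `f₁, f₂ ∈ π`) together with a family `loc v` of complex numbers, meant as the local normalised
doubling zeta integrals `Z_v^*(s_{m,n}, φ_{1,v} ⊗ φ̄_{2,v}, f_{1,v}, f_{2,v})` of §11.6 when the quadruple is a
pure tensor.  The LOCAL TEST DATA at a finite place are t6-p5's: GQT's zeta datum `Z` of the N4.2 datum at `v`
(`zetaSplit` / `zetaNonsplit`: `R(V_v)`, `π_v^∨`, the trilinear form `Z_v^*(s)` on `R(V_v) × π_v^∨ × π_v`), a
local test datum being a triple `(Φ_v, f_{2,v}^∨, f_{1,v}) ∈ R(V_v) × π_v^∨ × π_v` with the value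
`Z_v^*(½)(Φ_v, f_{2,v}^∨, f_{1,v})` (`NSide.LocalTest`, `NSide.zvalue`).  `TauDatum X s` = the set `Pure` of
quadruples that ARE restricted pure tensors with `loc` their local factors (GQT (11.3)), the unramified datum
`sph v`, the normalising factor `dv v = d_v(s_{m,n}, χ_V)` of §11.6, and the RESTRICTED-TENSOR ASSEMBLY
`assemble`: a family of local finite test data (spherical off `S`) ↦ the global pure tensor whose archimedean
components are the FORCED ones — the Fock vectors `φ₁₂,∞` (fixed inside t6-p3's `Θ`) and the `τ′`-vectors of
N4.3 — with its local factors (N4.3's `Z^*_{τ′_j}(½)` at the real places, the local values at the finite ones).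
The four `assemble_*` fields are DEFINITIONAL (the restricted tensor product `ω = ⊗′ ω_v`, `π₀ = ⊗′ π₀,v` — Flath,
Bump Thm 3.3.3 / 3.4.4, the print of record of N4.3's G-N4.3.6 — read off on the assembled vector);
`dv_ne_zero` is ELEMENTARY (a finite product of local Hecke `L`-factors `(1 − a q^{−s})^{−1}`, each a non-zero
complex number; GQT §11.6: «When `s > 0`, `d_v(s, χ_V)` has no poles»).  No field is a theorem of the record;
no display is declared here.

§8(d): uses an L-value-free non-vanishing device: NO.
-/

namespace Summit.Ventures.HodgeRepro2.T6

open N42Defs N42Datum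

namespace NSide

variable (s : NSide)

/-- GQT's zeta datum of the N4.2 datum at the finite place `v` (t6-p5's `zetaSplit` at a split place,
`zetaNonsplit` at a non-split one), with its dual pair. -/
def zetaPair : s.d42.Place → Σ S : DualPairDatum, ZetaDatum S :=
  Sum.elim (fun v => ⟨_, s.d42.zetaSplit v⟩) (fun v => ⟨_, s.d42.zetaNonsplit v⟩)

/-- The local test data at the finite place `v`: triples `(Φ_v, f_{2,v}^∨, f_{1,v}) ∈ R(V_v) × π_v^∨ × π_v`
of GQT §11.6 / §11.8, on t6-p5's zeta datum at `v`. -/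
def LocalTest (v : s.d42.Place) : Type :=
  (s.zetaPair v).2.R × (s.zetaPair v).2.Vdual × (s.zetaPair v).1.Vπ

/-- The value `Z_v^*(½)(Φ_v, f_{2,v}^∨, f_{1,v})` of the normalised local doubling zeta integral at
`s_{m,n} = ½` on a local test datum (t6-p5's trilinear form `Zstar (1/2)`). -/
noncomputable def zvalue (v : s.d42.Place) (t : s.LocalTest v) : ℂ :=
  (s.zetaPair v).2.Zstar (1 / 2) t.1 t.2.1 t.2.2

/-- t6-p5's «`Z_v^*(½) ≢ 0`» at `v` (`FinitePlacesDatum.ZetaNonzeroAt`) is the non-vanishing of the trilinear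
form of the zeta datum at `v`. -/
theorem zetaNonzeroAt_iff (v : s.d42.Place) : s.d42.ZetaNonzeroAt v ↔ (s.zetaPair v).2.Nonzero := by
  cases v <;> exact Iff.rfl

end NSide

/-- GQT's global test data of the Rallis inner-product formula on one side: `(φ₁, φ₂, f₁, f₂)` with
`φ_i ∈ 𝒮(𝕏(𝔸_f))` (archimedean part the fixed Fock datum, t6-p3's convention for `Θ`), `f_i ∈ L²([H])`,
and the family `loc v` of complex numbers meant as the local normalised doubling zeta integrals
`Z_v^*(s_{m,n}, φ_{1,v} ⊗ φ̄_{2,v}, f_{1,v}, f_{2,v})` (GQT §11.6, `s_{m,n} = ½`) when the quadruple is a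
pure tensor.  A bare record: which quadruples are pure tensors with these local factors is the datum's set
`TauDatum.Pure`. -/
structure PureData {LG : Type} [NormedAddCommGroup LG] [InnerProductSpace ℂ LG] {Gf : Type} [Group Gf]
    (X : N3Side LG Gf) (s : NSide) where
  /-- `φ₁ ∈ ω`, the first global Schwartz datum (finite part; archimedean part fixed) -/
  φ₁ : X.S
  /-- `φ₂ ∈ ω`, the second global Schwartz datum -/
  φ₂ : X.S
  /-- `f₁ ∈ π` -/
  f₁ : X.LH
  /-- `f₂ ∈ π` -/
  f₂ : X.LH
  /-- `v ↦ Z_v^*(s_{m,n}, φ_{1,v} ⊗ φ̄_{2,v}, f_{1,v}, f_{2,v})`, the local factors of (11.3) -/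
  loc : s.Place → ℂ

/-- The pure-tensor test datum of the Rallis inner-product formula on one side of the seesaw (side A:
`X = M.d3.A`, `s = M.sA`; side B likewise).  Fields are DATA, definitional identities of the assembled pure
tensor, and one elementary fact; the printed statements about them are the displays of T6N41TauHyp. -/
structure TauDatum {LG : Type} [NormedAddCommGroup LG] [InnerProductSpace ℂ LG] {Gf : Type} [Group Gf]
    (X : N3Side LG Gf) (s : NSide) where
  /-- the quadruples that are restricted PURE TENSORS `φ_i = ⊗_v φ_{i,v}`, `f_i = ⊗_v f_{i,v}` with `loc`
  their local factors — the data for which GQT's (11.3) `Z^*(s, Φ, f₁, f₂) = ∏_v Z_v^*(s, Φ_v, f_{1,v}, f_{2,v})`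
  is the definition of the global normalised zeta integral -/
  Pure : Set (PureData X s)
  /-- the unramified test datum at the finite place `v` («every data involved is unramified», GQT §11.6):
  the spherical section and the normalised spherical vectors -/
  sph : ∀ v, s.LocalTest v
  /-- `d_v(s_{m,n}, χ_V)`, «the product of a number of explicit Hecke `L`-factors» of GQT §11.6 /
  Lapid–Rallis p. 334 Remark 3, at `s_{m,n} = ½` -/
  dv : s.d42.Place → ℂ
  /-- [elementary] at an unramified place `d_v(½, χ_V) ≠ 0`: a finite product of local Hecke `L`-factors
  `(1 − a q^{−s})^{−1}`, each a non-zero complex number (finite since «when `s > 0`, `d_v(s, χ_V)` has no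
  poles», GQT §11.6 l. 26) -/
  dv_ne_zero : ∀ v, Sum.inl v ∉ s.d41.S → dv v ≠ 0
  /-- the RESTRICTED-TENSOR ASSEMBLY: a family of local finite test data `x v ∈ R(V_v) × π_v^∨ × π_v` ↦ the
  global quadruple `(φ₁, φ₂, f₁, f₂)` whose finite components are `x` and whose archimedean components are
  the forced ones (the Fock vectors `φ₁₂,∞`, the `τ′`-vectors `f_{τ′_j}` of N4.3 (P2), in both slots), with its
  local factors -/
  assemble : (∀ v, s.LocalTest v) → PureData X s
  /-- [definitional] a family that is spherical off `S` assembles to a restricted pure tensor -/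
  assemble_pure : ∀ x, (∀ v, Sum.inl v ∉ s.d41.S → x v = sph v) → assemble x ∈ Pure
  /-- [definitional] the local factor of the assembled datum at a finite place is the local value
  `Z_v^*(½)` on the local test datum -/
  assemble_loc_fin : ∀ x v, (assemble x).loc (Sum.inl v) = s.zvalue v (x v)
  /-- [definitional] the local factor at the real place `τ′_j` is N4.3's `Z^*_{τ′_j}(½)` on the forced
  diagonal datum (the Fock vector and the `τ′`-vector in both slots) — t6-p6's `zetaStarAt` of the N4.3
  bundle with the archimedean `L`-factors identified with N4.1's by construction (`withLfac`) -/
  assemble_loc_arch : ∀ x j,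
    (assemble x).loc (Sum.inr j) = (s.d43.withLfac fun j => s.d41.Lv (Sum.inr j)).zetaStarAt j
  /-- [definitional] the first cusp form of the assembled datum lies in `π₀` and has archimedean component
  in `τ′` (its archimedean components are the `τ′`-vectors `f_{τ′_j} ∈ π₀,τ′_j`; `π₀ = ⊗′ π₀,v`) -/
  assemble_f₁_mem : ∀ x, (assemble x).f₁ ∈ X.π₀ ⊓ X.τ'iso

namespace TauDatum

variable {LG : Type} [NormedAddCommGroup LG] [InnerProductSpace ℂ LG] {Gf : Type} [Group Gf]
  {X : N3Side LG Gf} {s : NSide} (Td : TauDatum X s)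

/-- [definition] a family of local finite test data is RESTRICTED when it is the unramified datum off `S`. -/
def Restricted (x : ∀ v, s.LocalTest v) : Prop :=
  ∀ v, Sum.inl v ∉ s.d41.S → x v = Td.sph v

/-- A restricted family assembles into `Pure`. -/
theorem assemble_mem {x : ∀ v, s.LocalTest v} (hx : Td.Restricted x) : Td.assemble x ∈ Td.Pure :=
  Td.assemble_pure x hx

end TauDatum

end Summit.Ventures.HodgeRepro2.T6
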